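import Summits.QuantumFields.YangMills.Theorems.AlphaInputsT3ACv3LinearLiftMatrixCLM
import Summits.QuantumFields.YangMills.Theorems.AlphaInputsT3ACv3LinearLiftSupport
import HarnessLib

/-!
# `AlphaInputsT3ACv3LinearLiftMatrixLocal` — (V) THE MATRIX-VALUED PORT OF THE (LL) ENGINE, PART 9: LOCALITY of the sup-small matrix lift `liftSM` (★w2 g2's `liftS_congr_local`
# read entrywise): `liftSM k A b` depends only on the coarse matrix data within sup-distance `3` cells of `b₋`; vanishing off the support; ★★ the LOCAL sup bound
# `‖liftSM k A b‖ ≤ (C_S∕L^k)·M` from `‖A‖ ≤ M` on that neighbourhood only (SAME constant as the global bound) — the letter ★w4's STENCIL version of the Newton right inverse asked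
# for (R6-FLAT CLAIM 2026-08-28T01:41:16Z) — cell `ym3-torus`, width seat `ym-ust-19936-w3` (g0)

WHY.  The Newton right inverse of RULING g24-№4 is the torus operator `R = liftSCLM` (part 5); on a REGION∕STENCIL the data are only defined (or only small) near the stencil, so the
executors need that `R u (b)` reads `u` only on the cells within a fixed sup-distance of `b` and is bounded by the LOCAL sup of `u` there.  ★w2 g2 landed the scalar letters
(`LinearLiftSpread.liftS_congr_local`, `liftS_eq_zero_of_local`, `abs_liftS_le_local`, predicate `NearR k r x y`, p595415); THIS FILE ports them to `M_n(ℂ)`-valued data through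
`byEntry` (parts 1∕5): ★ `liftSM_congr_local`, `liftSM_eq_zero_of_local`, ★★ `norm_liftSM_le_local` (`(C_S∕L^k)·M`, no `|n|²` — the scalar local bound through the `ℓ^∞` port
`norm_byEntry_le_of_bound` with the sub-family `NearR k 3 b₋`), and the CLM∕subtype readings `norm_liftSCLM_apply_le_local`, `liftSCLM_apply_eq_zero_of_local`.
HONEST FRAMING.  Finite-dimensional real linear algebra; nothing of [Balaban1985UV3]∕[Balaban1985Variational]∕[Balaban1985Averaging] is asserted; (FL)∕`hLift`, the stub 2′χ, the
crux `HistoryTailL` and any gap are NOT claimed; count-neutral helper (`--supports stmt-QuantumFields-19936`); registry untouched.  YM₃ on the three-torus is a RUNG of the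
programme, not the Clay problem; nothing here is about d = 4, infinite volume or a mass gap.

References: T. Bałaban, Commun. Math. Phys. 109 (1987) 249–301 [Balaban1987RG1] ((0.4), (0.11) p.253); Commun. Math. Phys. 98 (1985) 17–51 [Balaban1985Averaging] (p.24:
locality of the averaging operation).
-/

set_option autoImplicit false

noncomputable section

open scoped Matrix.Norms.L2Operator

namespace Summit.QuantumFields.YangMills.Theorems.LinearLiftMatrix

open Finset
open Literature.MathematicalPhysics.QuantumFieldTheory.Balaban1983to89
open Literature.MathematicalPhysics.QuantumFieldTheory.Balaban1985CMP102.Setting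
open Literature.MathematicalPhysics.QuantumFieldTheory.Balaban1983to89.B5Eq118OneStroke (iterBlockOf)
open Summit.QuantumFields.Balaban3D.Carriers
open Summit.QuantumFields.YangMills.Theorems.LinearLiftProfile
open Summit.QuantumFields.YangMills.Theorems.LinearLiftSpread (hh liftS liftSL liftSL_apply NearR Near near_self nearR_of_near nearR_mono liftS_congr_local abs_liftS_le_local)

section Local

variable {P : Params} {n : Type*} (k : ℕ) (hk : k ≤ P.m + P.K)
include hk

/-- **★ LOCALITY OF THE SUP-SMALL MATRIX LIFT**: if the matrix data `A`, `A'` agree on every coarse bond issuing from a cell within sup-distance `3` of the cell of `b₋`, then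
`liftSM k A b = liftSM k A' b` (★w2 g2's `liftS_congr_local` on the real and imaginary part of every entry). [cite: Balaban1985Averaging, p.24] -/
theorem liftSM_congr_local (A A' : PBond P k → Matrix n n ℂ) (b : PBond P 0) (h : ∀ (y : Site P k) (μ : Fin P.d), NearR k 3 b.src y → A ⟨y, μ⟩ = A' ⟨y, μ⟩) :
    liftSM k A b = liftSM k A' b := by
  ext i l
  apply Complex.ext
  · rw [liftSM_eq, liftSM_eq, byEntry_apply_re, byEntry_apply_re]
    exact liftS_congr_local k hk _ _ b fun y μ hy => by simp only [h y μ hy]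
  · rw [liftSM_eq, liftSM_eq, byEntry_apply_im, byEntry_apply_im]
    exact liftS_congr_local k hk _ _ b fun y μ hy => by simp only [h y μ hy]

/-- **VANISHING OFF THE SUPPORT**: if `A ⟨y, μ⟩ = 0` for every cell `y` within sup-distance `3` of the cell of `b₋`, then `liftSM k A b = 0`. [cite: Balaban1985Averaging, p.24] -/
theorem liftSM_eq_zero_of_local (A : PBond P k → Matrix n n ℂ) (b : PBond P 0) (h : ∀ (y : Site P k) (μ : Fin P.d), NearR k 3 b.src y → A ⟨y, μ⟩ = 0) :
    liftSM k A b = 0 := by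
  classical
  have h0 : liftSM k (0 : PBond P k → Matrix n n ℂ) b = 0 := by
    rw [liftSM_eq, byEntry_congr (T := liftS k) (fun f => (liftSL_apply k f).symm), byEntry_eq_sum_kernel]
    simp
  rw [liftSM_congr_local k hk A 0 b fun y μ hy => by rw [h y μ hy]; rfl, h0]

/-- **★★ THE LOCAL SUP BOUND OF THE SUP-SMALL MATRIX LIFT, SAME CONSTANT**: `‖liftSM k A b‖ ≤ (C_S∕L^k)·M` as soon as `‖A ⟨y, μ⟩‖ ≤ M` for the cells `y` within sup-distance `3` of
the cell of `b₋` (all directions) — ★w2 g2's `abs_liftS_le_local` through the `ℓ^∞` port with the sub-family `NearR k 3 b₋` (no `|n|²`). [cite: Balaban1987RG1, (0.4)+(0.11) p.253] -/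
theorem norm_liftSM_le_local [Fintype n] [DecidableEq n] (A : PBond P k → Matrix n n ℂ) (b : PBond P 0) {M : ℝ}
    (hA : ∀ (y : Site P k) (μ : Fin P.d), NearR k 3 b.src y → ‖A ⟨y, μ⟩‖ ≤ M) :
    ‖liftSM k A b‖ ≤ (CS P / (P.L : ℝ) ^ k) * M := by
  classical
  have hM : 0 ≤ M := (norm_nonneg _).trans (hA (iterBlockOf k b.src) b.dir (nearR_mono k (by norm_num) (nearR_of_near k (near_self k hk b.src))))
  rw [liftSM_eq, byEntry_congr (T := liftS k) (fun f => (liftSL_apply k f).symm)]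
  refine norm_byEntry_le_of_bound (liftSL P k) (fun c : PBond P k => NearR k 3 b.src c.src) b (fun f M' hf => ?_) A hM fun c hc => hA c.src c.dir hc
  have h := abs_liftS_le_local k hk f b (M := M') fun y μ hy => hf ⟨y, μ⟩ hy
  unfold CS
  calc |liftSL P k f b| = |liftS k f b| := rfl
    _ ≤ (18 : ℝ) ^ P.d * (2 + ((P.d : ℝ) + 1) * (18 : ℝ) ^ P.d) * M' / (P.L : ℝ) ^ k := h
    _ = (18 : ℝ) ^ P.d * (2 + ((P.d : ℝ) + 1) * (18 : ℝ) ^ P.d) / (P.L : ℝ) ^ k * M' := by ring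

/-- **THE LOCAL SUP BOUND, CLM READING**: `‖liftSCLM P k hk u b‖ ≤ (C_S∕L^k)·M` from `‖u ⟨y, μ⟩‖ ≤ M` on the cells within sup-distance `3` of `b₋`. [cite: Balaban1987RG1, (0.4)+(0.11) p.253] -/
theorem norm_liftSCLM_apply_le_local [Fintype n] [DecidableEq n] (u : PBond P k → Matrix n n ℂ) (b : PBond P 0) {M : ℝ}
    (hu : ∀ (y : Site P k) (μ : Fin P.d), NearR k 3 b.src y → ‖u ⟨y, μ⟩‖ ≤ M) :
    ‖liftSCLM P k hk u b‖ ≤ (CS P / (P.L : ℝ) ^ k) * M := by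
  rw [liftSCLM_apply]
  exact norm_liftSM_le_local k hk u b hu

/-- **VANISHING OFF THE SUPPORT, CLM READING**: `liftSCLM P k hk u b = 0` when `u` vanishes on the cells within sup-distance `3` of `b₋`. [cite: Balaban1985Averaging, p.24] -/
theorem liftSCLM_apply_eq_zero_of_local [Fintype n] [DecidableEq n] (u : PBond P k → Matrix n n ℂ) (b : PBond P 0)
    (hu : ∀ (y : Site P k) (μ : Fin P.d), NearR k 3 b.src y → u ⟨y, μ⟩ = 0) : liftSCLM P k hk u b = 0 := by
  rw [liftSCLM_apply]
  exact liftSM_eq_zero_of_local k hk u b hu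

end Local

end Summit.QuantumFields.YangMills.Theorems.LinearLiftMatrix

end
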